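import Summits.CriticalPhenomena.PercolationContinuityZ3.Theorems.FK.UniquenessOfNonPercolation
import Summits.CriticalPhenomena.PercolationContinuityZ3.Theorems.FK.InfiniteVolumeStochasticOrder
import Summits.CriticalPhenomena.PercolationContinuityZ3.Theorems.FK.RegionLawMonotone
import HarnessLib

/-!
# FK-continuity cell, FO-10a: in a box, on `{Λ ↮ ∂Δ}` the WIRED measure is the smallest of the class —
# `φ¹_{p,q}(A; Λ ↮ ∂Δ) ≤ P(A; Λ ↮ ∂Δ)` for every `FKGibbs` measure `P` and every increasing `E_Λ`-local `A`
# (Grimmett 2006, proof of Thm. (5.16)(c): the free-island step of Prop. (5.30), coupling-free)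

Registered R76 (cell INBOX l.5704, 2026-08-23); registry row FO-10a-g336; label THU-A (coordinator fk-4 g167).
Cell `fk-continuity` (bschramm), row FO-10a (domain-Markov + comparison layer over FO-06); support file
for the FK-continuity transplant (`--supports stmt-CriticalPhenomena-4575`); builds on p205010 (kernel
theorem, internal audit signed; external expert review pending). Pure proofs; no definitions, no named
facts, no sorries; general dimension `d`.

The sandwich `φ⁰_{p,q} ≤st P ≤st φ¹_{p,q}` (Grimmett 2006, (4.21)/(4.35); cell: `InfiniteVolumeStochasticOrder.lean`)
orders the class `FKGibbs d p q` on increasing events. This file proves the REVERSED comparison inside a free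
island: for finite `Λ ⊆ Δ`, `A` increasing and determined by `E_Λ`, and every `P` of the class (`0 ≤ p ≤ 1`, `q ≥ 1`),

  `φ¹_{p,q}(A ∩ {Λ ↮ ∂Δ inside Δ}) ≤ P(A ∩ {Λ ↮ ∂Δ inside Δ})`  (`FKGibbs.rcLimit_true_real_inter_setOf_forall_not_bdryReach_le`).

This is the content of the coupling `ψ_Δ` of Grimmett's Prop. (5.30) ("conditional on the free island `G`, both
marginals on `E_G` are the free measure `φ_G`") and of the display following it, obtained WITHOUT couplings:

* decompose `{Λ ↮ ∂Δ inside Δ}` by the free island `G(ω) = {x ∈ Δ : x ↮ ∂Δ inside Δ}` (the events `{G = g}`, their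
  locality and closed edge boundary are `UniquenessOfNonPercolation.lean`); for a box limit,
  `P(A ∩ {G = g}) = φ⁰_g(A) · P(G = g)` (free Markov property across a closed edge boundary,
  `InfiniteVolumeClosedBoundaryFree.lean`), so `φ¹_{p,q}(A; Λ ↮ ∂Δ) = ∫ f dφ¹_{p,q}` for the simple function
  `f = Σ_g φ⁰_g(A) 1_{G = g}` (`IsBoxLimit.real_inter_setOf_forall_not_bdryReach_eq_sum`, `integral_sum_indicator_island`);
* `f` is DECREASING in `ω`: opening edges shrinks the island, and `g ↦ φ⁰_g(A)` is increasing in `g`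
  (`regionFreeReal_mono`, FO-10a `RegionLawMonotone.lean`, Grimmett's (4.24)) — `antitone_sum_indicator_island`;
  hence `∫ f dφ¹_{p,q} ≤ ∫ f dP` by `P ≤st φ¹_{p,q}` (`FKGibbs.integral_le_rcLimit_true`);
* `∫ f dP = Σ_g φ⁰_g(A) P(G = g) ≤ Σ_g P(A ∩ {G = g}) = P(A; Λ ↮ ∂Δ)` by the lower sandwich of the class
  (`FKGibbs.free_mul_le`) — `FKGibbs.sum_regionFreeReal_mul_real_island_le`.

The passage `Δ = Λ_n ↑ ℤ^d` is the companion `WiredMinimalOnFiniteClusters.lean`; the application to Thm. (5.16)(c)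
(`θ⁰ = θ¹ ⇒ φ⁰_{p,q} = φ¹_{p,q}`) is `UniquenessOfEqualTheta.lean`.

## References
* G. Grimmett, *The Random-Cluster Model*, Springer 2006 (`book:grimmett2006-random-cluster-model`):
  Lemma (4.13), Thm. (4.19) (4.20)–(4.21), (4.24), Thm. (4.34) (4.35) [PDF pp. 71–81]; §5.2, proof of
  Thm. (5.16)(c), eqs. (5.28)–(5.29) and Prop. (5.30) [PDF pp. 103–107]. [Grimmett2006]
-/

noncomputable section

open MeasureTheory Set Filter
open scoped Topology ENNReal

namespace Summit.CriticalPhenomena.PercolationContinuityZ3.Theorems.FK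

open Literature.Probability.Percolation Literature.Probability.LatticeModels


/-! ## The free island shrinks when edges are opened -/

section Island

variable {d : ℕ}

/-- Being joined to `∂Δ` inside `Δ` is increasing in the configuration. [cite: Grimmett2006, §5.2, proof of Thm. (5.16)(c) (the set G)] -/
theorem bdryReach_mono {Δ : Finset (Site d)} {ω ω' : BondConfig (Site d)} (h : ω ⊆ ω') {x : Site d}
    (hx : ∃ y ∈ innerBoundary (zdGraph d) Δ,
      (openGraph ω ⊓ withinGraph (zdGraph d) (↑Δ : Set (Site d))).Reachable y x) :
    ∃ y ∈ innerBoundary (zdGraph d) Δ,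
      (openGraph ω' ⊓ withinGraph (zdGraph d) (↑Δ : Set (Site d))).Reachable y x := by
  obtain ⟨y, hy, hyx⟩ := hx
  exact ⟨y, hy, hyx.mono (inf_le_inf_right _ (openGraph_mono h))⟩

/-- The open graph inside `Δ` only depends on the edges `E_Δ`. [folklore] -/
theorem openGraph_inf_withinGraph_eq_of_inter_eq {Δ : Finset (Site d)} {ω₁ ω₂ : BondConfig (Site d)}
    (h : ω₁ ∩ ↑(edgesIn (zdGraph d) Δ) = ω₂ ∩ ↑(edgesIn (zdGraph d) Δ)) :
    openGraph ω₁ ⊓ withinGraph (zdGraph d) (↑Δ : Set (Site d)) =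
      openGraph ω₂ ⊓ withinGraph (zdGraph d) (↑Δ : Set (Site d)) := by
  have key : ∀ {ω ω' : BondConfig (Site d)}, ω ∩ ↑(edgesIn (zdGraph d) Δ) = ω' ∩ ↑(edgesIn (zdGraph d) Δ) →
      ∀ a b, (openGraph ω ⊓ withinGraph (zdGraph d) (↑Δ : Set (Site d))).Adj a b →
        (openGraph ω' ⊓ withinGraph (zdGraph d) (↑Δ : Set (Site d))).Adj a b := by
    intro ω ω' hωω' a b hab
    rw [SimpleGraph.inf_adj, openGraph_adj, withinGraph_adj] at hab ⊢
    obtain ⟨⟨hmem, hne⟩, hadj, ha, hb⟩ := hab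
    have he : s(a, b) ∈ (↑(edgesIn (zdGraph d) Δ) : Set (Sym2 (Site d))) := by
      rw [Finset.mem_coe, mem_edgesIn_iff]
      refine ⟨(SimpleGraph.mem_edgeSet _).2 hadj, fun z hz => ?_⟩
      rcases Sym2.mem_iff.1 hz with rfl | rfl
      · exact Finset.mem_coe.1 ha
      · exact Finset.mem_coe.1 hb
    have : s(a, b) ∈ ω' ∩ ↑(edgesIn (zdGraph d) Δ) := hωω' ▸ ⟨hmem, he⟩
    exact ⟨⟨this.1, hne⟩, hadj, ha, hb⟩
  ext a b
  exact ⟨key h a b, key h.symm a b⟩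

/-- **The event "`x` is joined to `∂Δ` inside `Δ`" is determined by the edges `E_Δ`** (a cylinder event).
[cite: Grimmett2006, §5.2, proof of Thm. (5.16)(c) ({u ↔ ∂Λ} is a cylinder event)] -/
theorem determinedBy_setOf_bdryReach (Δ : Finset (Site d)) (x : Site d) :
    DeterminedBy {ω : BondConfig (Site d) | ∃ y ∈ innerBoundary (zdGraph d) Δ,
        (openGraph ω ⊓ withinGraph (zdGraph d) (↑Δ : Set (Site d))).Reachable y x}
      ↑(edgesIn (zdGraph d) Δ) := by
  rw [determinedBy_iff]
  intro ω₁ ω₂ h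
  simp only [Set.mem_setOf_eq, openGraph_inf_withinGraph_eq_of_inter_eq h]

/-- The free island of `ω` in `Δ`, as a finite set: a configuration lies in the event "the island is `g`"
iff `g` is the set of vertices of `Δ` not joined to `∂Δ` inside `Δ`. [cite: Grimmett2006, §5.2, proof of Thm. (5.16)(c) (the set G)] -/
theorem mem_setOf_island_iff_eq_filter {Δ g : Finset (Site d)} {ω : BondConfig (Site d)}
    [DecidablePred fun x => ¬ ∃ y ∈ innerBoundary (zdGraph d) Δ,
      (openGraph ω ⊓ withinGraph (zdGraph d) (↑Δ : Set (Site d))).Reachable y x] :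
    (ω ∈ {ω : BondConfig (Site d) | ∀ x, x ∈ g ↔ x ∈ Δ ∧ ¬ ∃ y ∈ innerBoundary (zdGraph d) Δ,
        (openGraph ω ⊓ withinGraph (zdGraph d) (↑Δ : Set (Site d))).Reachable y x}) ↔
      g = Δ.filter fun x => ¬ ∃ y ∈ innerBoundary (zdGraph d) Δ,
        (openGraph ω ⊓ withinGraph (zdGraph d) (↑Δ : Set (Site d))).Reachable y x := by
  rw [Set.mem_setOf_eq]
  constructor
  · intro h
    ext x
    rw [Finset.mem_filter]
    exact h x
  · rintro rfl x
    rw [Finset.mem_filter]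

/-- **The simple function `f = Σ_{g ⊇ Λ} φ⁰_g(A) · 1_{G = g}` is decreasing** (`A` increasing, `0 ≤ p ≤ 1`,
`q ≥ 1`): opening edges shrinks the free island `G`, and the free region law `g ↦ φ⁰_{g,p,q}(A)` increases
with `g` (Grimmett's (4.24)). [cite: Grimmett2006, Thm. (4.19)(a) eq. (4.24); §5.2 proof of Thm. (5.16)(c)] -/
theorem antitone_sum_indicator_island {p q : ℝ} (hp : p ∈ Set.Icc (0 : ℝ) 1) (hq : 1 ≤ q)
    (Λ Δ : Finset (Site d)) {A : Set (BondConfig (Site d))} (hA : IsUpperSet A) :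
    Antitone fun ω : BondConfig (Site d) =>
      ∑ g ∈ Δ.powerset.filter (fun g => Λ ⊆ g),
        {ω : BondConfig (Site d) | ∀ x, x ∈ g ↔ x ∈ Δ ∧ ¬ ∃ y ∈ innerBoundary (zdGraph d) Δ,
          (openGraph ω ⊓ withinGraph (zdGraph d) (↑Δ : Set (Site d))).Reachable y x}.indicator
          (fun _ => regionFreeReal d p q g A) ω := by
  classical
  -- the value of the sum at `ω`: `φ⁰_{G(ω)}(A)` if `Λ ⊆ G(ω)`, else `0`
  set G : BondConfig (Site d) → Finset (Site d) := fun ω => Δ.filter fun x =>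
    ¬ ∃ y ∈ innerBoundary (zdGraph d) Δ,
      (openGraph ω ⊓ withinGraph (zdGraph d) (↑Δ : Set (Site d))).Reachable y x with hG
  have hval : ∀ ω, (∑ g ∈ Δ.powerset.filter (fun g => Λ ⊆ g),
      {ω : BondConfig (Site d) | ∀ x, x ∈ g ↔ x ∈ Δ ∧ ¬ ∃ y ∈ innerBoundary (zdGraph d) Δ,
        (openGraph ω ⊓ withinGraph (zdGraph d) (↑Δ : Set (Site d))).Reachable y x}.indicator
        (fun _ => regionFreeReal d p q g A) ω) =
      if Λ ⊆ G ω then regionFreeReal d p q (G ω) A else 0 := by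
    intro ω
    have hind : ∀ g ∈ Δ.powerset.filter (fun g => Λ ⊆ g),
        {ω : BondConfig (Site d) | ∀ x, x ∈ g ↔ x ∈ Δ ∧ ¬ ∃ y ∈ innerBoundary (zdGraph d) Δ,
          (openGraph ω ⊓ withinGraph (zdGraph d) (↑Δ : Set (Site d))).Reachable y x}.indicator
          (fun _ => regionFreeReal d p q g A) ω =
        if g = G ω then regionFreeReal d p q g A else 0 := by
      intro g _
      by_cases hg : g = G ω
      · rw [if_pos hg, Set.indicator_of_mem (mem_setOf_island_iff_eq_filter.2 hg)]
      · rw [if_neg hg, Set.indicator_of_notMem (fun h => hg (mem_setOf_island_iff_eq_filter.1 h))]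
    rw [Finset.sum_congr rfl hind, Finset.sum_ite_eq']
    have hGΔ : G ω ⊆ Δ := Finset.filter_subset _ _
    by_cases hΛ : Λ ⊆ G ω
    · rw [if_pos hΛ, if_pos (Finset.mem_filter.2 ⟨Finset.mem_powerset.2 hGΔ, hΛ⟩)]
    · rw [if_neg hΛ, if_neg (fun h => hΛ (Finset.mem_filter.1 h).2)]
  intro ω ω' hle
  simp only [hval]
  -- the island shrinks: `G ω' ⊆ G ω`
  have hGG : G ω' ⊆ G ω := by
    intro x hx
    rw [hG, Finset.mem_filter] at hx ⊢
    exact ⟨hx.1, fun h => hx.2 (bdryReach_mono hle h)⟩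
  by_cases hΛ' : Λ ⊆ G ω'
  · rw [if_pos hΛ', if_pos (hΛ'.trans hGG)]
    exact regionFreeReal_mono hp hq hGG hA
  · rw [if_neg hΛ']
    split_ifs
    · exact regionFreeReal_nonneg _ _ _ _
    · exact le_rfl

/-- The simple function `Σ_{g ⊇ Λ} φ⁰_g(A) · 1_{G = g}` is measurable. [cite: Grimmett2006, §5.2 proof of Thm. (5.16)(c)] -/
theorem measurable_sum_indicator_island (p q : ℝ) (Λ Δ : Finset (Site d)) (A : Set (BondConfig (Site d))) :
    Measurable fun ω : BondConfig (Site d) =>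
      ∑ g ∈ Δ.powerset.filter (fun g => Λ ⊆ g),
        {ω : BondConfig (Site d) | ∀ x, x ∈ g ↔ x ∈ Δ ∧ ¬ ∃ y ∈ innerBoundary (zdGraph d) Δ,
          (openGraph ω ⊓ withinGraph (zdGraph d) (↑Δ : Set (Site d))).Reachable y x}.indicator
          (fun _ => regionFreeReal d p q g A) ω := by
  refine Finset.measurable_sum _ fun g _ => measurable_const.indicator ?_
  exact measurableSet_of_isLocalEvent_holds ⟨_, determinedBy_setOf_island Δ g⟩

/-- The simple function `Σ_{g ⊇ Λ} φ⁰_g(A) · 1_{G = g}` takes values in `[0, 1]` (`0 ≤ p ≤ 1`, `q > 0`).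
[cite: Grimmett2006, §5.2 proof of Thm. (5.16)(c)] -/
theorem abs_sum_indicator_island_le_one {p q : ℝ} (hp : p ∈ Set.Icc (0 : ℝ) 1) (hq : 0 < q)
    (Λ Δ : Finset (Site d)) (A : Set (BondConfig (Site d))) (ω : BondConfig (Site d)) :
    |∑ g ∈ Δ.powerset.filter (fun g => Λ ⊆ g),
        {ω : BondConfig (Site d) | ∀ x, x ∈ g ↔ x ∈ Δ ∧ ¬ ∃ y ∈ innerBoundary (zdGraph d) Δ,
          (openGraph ω ⊓ withinGraph (zdGraph d) (↑Δ : Set (Site d))).Reachable y x}.indicator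
          (fun _ => regionFreeReal d p q g A) ω| ≤ 1 := by
  classical
  set G : Finset (Site d) := Δ.filter fun x =>
    ¬ ∃ y ∈ innerBoundary (zdGraph d) Δ,
      (openGraph ω ⊓ withinGraph (zdGraph d) (↑Δ : Set (Site d))).Reachable y x with hG
  have hle1 : ∀ g : Finset (Site d), regionFreeReal d p q g A ≤ 1 := by
    intro g
    haveI := isProbabilityMeasure_rcMeasure (finsetGraph (zdGraph d) g) hp hq (∅ : Set ↥g)
    exact measureReal_le_one
  have hterm : ∀ g ∈ Δ.powerset.filter (fun g => Λ ⊆ g),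
      {ω : BondConfig (Site d) | ∀ x, x ∈ g ↔ x ∈ Δ ∧ ¬ ∃ y ∈ innerBoundary (zdGraph d) Δ,
        (openGraph ω ⊓ withinGraph (zdGraph d) (↑Δ : Set (Site d))).Reachable y x}.indicator
        (fun _ => regionFreeReal d p q g A) ω =
      if g = G then regionFreeReal d p q g A else 0 := by
    intro g _
    by_cases hg : g = G
    · rw [if_pos hg, Set.indicator_of_mem (mem_setOf_island_iff_eq_filter.2 hg)]
    · rw [if_neg hg, Set.indicator_of_notMem (fun h => hg (mem_setOf_island_iff_eq_filter.1 h))]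
  rw [Finset.sum_congr rfl hterm, Finset.sum_ite_eq']
  split_ifs
  · rw [abs_of_nonneg (regionFreeReal_nonneg _ _ _ _)]
    exact hle1 G
  · simp

/-- The integral of the simple function: `∫ Σ_g φ⁰_g(A) 1_{G = g} dμ = Σ_g φ⁰_g(A) · μ(G = g)` for a finite
measure `μ`. [cite: Grimmett2006, §5.2 proof of Thm. (5.16)(c) (the sum over g ∈ 𝒢)] -/
theorem integral_sum_indicator_island (p q : ℝ) (Λ Δ : Finset (Site d)) (A : Set (BondConfig (Site d)))
    (μ : Measure (BondConfig (Site d))) [IsFiniteMeasure μ] :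
    ∫ ω, (∑ g ∈ Δ.powerset.filter (fun g => Λ ⊆ g),
        {ω : BondConfig (Site d) | ∀ x, x ∈ g ↔ x ∈ Δ ∧ ¬ ∃ y ∈ innerBoundary (zdGraph d) Δ,
          (openGraph ω ⊓ withinGraph (zdGraph d) (↑Δ : Set (Site d))).Reachable y x}.indicator
          (fun _ => regionFreeReal d p q g A) ω) ∂μ =
      ∑ g ∈ Δ.powerset.filter (fun g => Λ ⊆ g), regionFreeReal d p q g A *
        μ.real {ω : BondConfig (Site d) | ∀ x, x ∈ g ↔ x ∈ Δ ∧ ¬ ∃ y ∈ innerBoundary (zdGraph d) Δ,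
          (openGraph ω ⊓ withinGraph (zdGraph d) (↑Δ : Set (Site d))).Reachable y x} := by
  have hIm : ∀ g, MeasurableSet {ω : BondConfig (Site d) | ∀ x, x ∈ g ↔ x ∈ Δ ∧
      ¬ ∃ y ∈ innerBoundary (zdGraph d) Δ,
        (openGraph ω ⊓ withinGraph (zdGraph d) (↑Δ : Set (Site d))).Reachable y x} := fun g =>
    measurableSet_of_isLocalEvent_holds ⟨_, determinedBy_setOf_island Δ g⟩
  rw [integral_finsetSum _ fun g _ => (integrable_const _).indicator (hIm g)]
  refine Finset.sum_congr rfl fun g _ => ?_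
  rw [integral_indicator_const _ (hIm g), smul_eq_mul, mul_comm]

end Island

/-! ## In a box: `φ¹_{p,q}(A; Λ ↮ ∂Δ) ≤ P(A; Λ ↮ ∂Δ)` for every `P` of the class -/

section Box

variable {d : ℕ} {b : Bool} {p q : ℝ} {P : Measure (BondConfig (Site d))}

/-- **Decomposition by the free island, for a box limit** (exact): for `P` a box limit (`0 ≤ p ≤ 1`,
`q > 0`), finite `Λ ⊆ Δ` and `A` determined by `E_Λ` (not necessarily monotone),
`P(A ∩ {Λ ↮ ∂Δ inside Δ}) = Σ_{Λ ⊆ g ⊆ Δ} φ⁰_{g,p,q}(A) · P(G = g)` — on each island the configuration is free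
(`IsBoxLimit.real_inter_eq_regionFreeReal_mul_of_closed`). [cite: Grimmett2006, Lemma (4.13) with §5.2 Prop. (5.30)] -/
theorem IsBoxLimit.real_inter_setOf_forall_not_bdryReach_eq_sum (hP : IsBoxLimit d b p q P)
    (hp : p ∈ Set.Icc (0 : ℝ) 1) (hq : 0 < q) {Λ Δ : Finset (Site d)} (hΛΔ : Λ ⊆ Δ)
    {A : Set (BondConfig (Site d))} (hAΛ : DeterminedBy A ↑(edgesIn (zdGraph d) Λ)) :
    P.real (A ∩ {ω | ∀ x ∈ Λ, ¬ ∃ y ∈ innerBoundary (zdGraph d) Δ,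
        (openGraph ω ⊓ withinGraph (zdGraph d) (↑Δ : Set (Site d))).Reachable y x}) =
      ∑ g ∈ Δ.powerset.filter (fun g => Λ ⊆ g), regionFreeReal d p q g A *
        P.real {ω : BondConfig (Site d) | ∀ x, x ∈ g ↔ x ∈ Δ ∧ ¬ ∃ y ∈ innerBoundary (zdGraph d) Δ,
          (openGraph ω ⊓ withinGraph (zdGraph d) (↑Δ : Set (Site d))).Reachable y x} := by
  classical
  haveI := hP.isProbabilityMeasure
  set I : Finset (Site d) → Set (BondConfig (Site d)) := fun g =>
    {ω | ∀ x, x ∈ g ↔ x ∈ Δ ∧ ¬ ∃ y ∈ innerBoundary (zdGraph d) Δ,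
      (openGraph ω ⊓ withinGraph (zdGraph d) (↑Δ : Set (Site d))).Reachable y x} with hI
  set 𝒢 : Finset (Finset (Site d)) := Δ.powerset.filter (fun g => Λ ⊆ g) with h𝒢
  have hIm : ∀ g, MeasurableSet (I g) := fun g =>
    measurableSet_of_isLocalEvent_holds ⟨_, determinedBy_setOf_island Δ g⟩
  have hdisj : (↑𝒢 : Set (Finset (Site d))).PairwiseDisjoint I := fun g _ g' _ hne =>
    disjoint_setOf_island Δ hne
  have hdisjA : (↑𝒢 : Set (Finset (Site d))).PairwiseDisjoint (fun g => A ∩ I g) := fun g hg g' hg' hne =>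
    (hdisj hg hg' hne).mono Set.inter_subset_right Set.inter_subset_right
  have hAm : MeasurableSet A := measurableSet_of_isLocalEvent_holds ⟨_, hAΛ⟩
  have hterm : ∀ g ∈ 𝒢, P.real (A ∩ I g) = regionFreeReal d p q g A * P.real (I g) := by
    intro g hg
    rw [h𝒢, Finset.mem_filter, Finset.mem_powerset] at hg
    refine hP.real_inter_eq_regionFreeReal_mul_of_closed hp hq g (edgesIn (zdGraph d) Δ \ edgesIn (zdGraph d) g)
      (hAΛ.mono (edgesIn_subset_edgesIn_of_subset hg.2)) ?_ (determinedBy_setOf_island Δ g) ?_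
    · rw [Finset.coe_sdiff]
      exact disjoint_sdiff_left
    · intro ω hω x hx y hy hxy
      exact not_mem_of_island hω hx hy hxy
  rw [setOf_forall_not_bdryReach_eq_biUnion hΛΔ, Set.inter_iUnion₂]
  change P.real (⋃ g ∈ 𝒢, A ∩ I g) = ∑ g ∈ 𝒢, regionFreeReal d p q g A * P.real (I g)
  rw [measureReal_biUnion_finset hdisjA (fun g _ => hAm.inter (hIm g))]
  exact Finset.sum_congr rfl hterm

/-- **Lower sandwich summed over the islands**: for `P` of the class `FKGibbs d p q`, finite `Λ ⊆ Δ` and an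
increasing `A` determined by `E_Λ`, `Σ_{Λ ⊆ g ⊆ Δ} φ⁰_{g,p,q}(A) · P(G = g) ≤ P(A ∩ {Λ ↮ ∂Δ inside Δ})`
(`{G = g}` is determined by `E_Δ ∖ E_g`, so `φ⁰_g(A) P(G = g) ≤ P(A ∩ {G = g})` by `FKGibbs.free_mul_le`).
[cite: Grimmett2006, Lemma (4.13), Lemma (4.14)(b), Thm. (4.34)(b) eq. (4.35)] -/
theorem FKGibbs.sum_regionFreeReal_mul_real_island_le (hP : FKGibbs d p q P) {Λ Δ : Finset (Site d)}
    (hΛΔ : Λ ⊆ Δ) {A : Set (BondConfig (Site d))} (hA : IsUpperSet A)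
    (hAΛ : DeterminedBy A ↑(edgesIn (zdGraph d) Λ)) :
    ∑ g ∈ Δ.powerset.filter (fun g => Λ ⊆ g), regionFreeReal d p q g A *
        P.real {ω : BondConfig (Site d) | ∀ x, x ∈ g ↔ x ∈ Δ ∧ ¬ ∃ y ∈ innerBoundary (zdGraph d) Δ,
          (openGraph ω ⊓ withinGraph (zdGraph d) (↑Δ : Set (Site d))).Reachable y x} ≤
      P.real (A ∩ {ω | ∀ x ∈ Λ, ¬ ∃ y ∈ innerBoundary (zdGraph d) Δ,
        (openGraph ω ⊓ withinGraph (zdGraph d) (↑Δ : Set (Site d))).Reachable y x}) := by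
  classical
  haveI := hP.isProbabilityMeasure
  set I : Finset (Site d) → Set (BondConfig (Site d)) := fun g =>
    {ω | ∀ x, x ∈ g ↔ x ∈ Δ ∧ ¬ ∃ y ∈ innerBoundary (zdGraph d) Δ,
      (openGraph ω ⊓ withinGraph (zdGraph d) (↑Δ : Set (Site d))).Reachable y x} with hI
  set 𝒢 : Finset (Finset (Site d)) := Δ.powerset.filter (fun g => Λ ⊆ g) with h𝒢
  have hIm : ∀ g, MeasurableSet (I g) := fun g =>
    measurableSet_of_isLocalEvent_holds ⟨_, determinedBy_setOf_island Δ g⟩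
  have hdisj : (↑𝒢 : Set (Finset (Site d))).PairwiseDisjoint I := fun g _ g' _ hne =>
    disjoint_setOf_island Δ hne
  have hdisjA : (↑𝒢 : Set (Finset (Site d))).PairwiseDisjoint (fun g => A ∩ I g) := fun g hg g' hg' hne =>
    (hdisj hg hg' hne).mono Set.inter_subset_right Set.inter_subset_right
  have hAm : MeasurableSet A := measurableSet_of_isLocalEvent_holds ⟨_, hAΛ⟩
  have hterm : ∀ g ∈ 𝒢, regionFreeReal d p q g A * P.real (I g) ≤ P.real (A ∩ I g) := by
    intro g hg
    rw [h𝒢, Finset.mem_filter, Finset.mem_powerset] at hg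
    refine hP.free_mul_le g (edgesIn (zdGraph d) Δ \ edgesIn (zdGraph d) g) hA
      (hAΛ.mono (edgesIn_subset_edgesIn_of_subset hg.2)) ?_ (determinedBy_setOf_island Δ g)
    rw [Finset.coe_sdiff]
    exact disjoint_sdiff_left
  rw [setOf_forall_not_bdryReach_eq_biUnion hΛΔ, Set.inter_iUnion₂]
  change ∑ g ∈ 𝒢, regionFreeReal d p q g A * P.real (I g) ≤ P.real (⋃ g ∈ 𝒢, A ∩ I g)
  rw [measureReal_biUnion_finset hdisjA (fun g _ => hAm.inter (hIm g))]
  exact Finset.sum_le_sum hterm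

/-- **In a box, the wired measure is minimal on `{Λ ↮ ∂Δ}`**: for every `P` of the class `FKGibbs d p q`
(`0 ≤ p ≤ 1`, `q ≥ 1`), finite `Λ ⊆ Δ` and an increasing `A` determined by `E_Λ`,
`φ¹_{p,q}(A ∩ {Λ ↮ ∂Δ inside Δ}) ≤ P(A ∩ {Λ ↮ ∂Δ inside Δ})`: both sides are integrals of the decreasing
simple function `Σ_g φ⁰_g(A) 1_{G = g}` (exactly for `φ¹_{p,q}`, from below for `P`), and `P ≤st φ¹_{p,q}`.
Coupling-free form of Grimmett's display after Prop. (5.30). [cite: Grimmett2006, §5.2, proof of Thm. (5.16)(c), display after Prop. (5.30)] -/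
theorem FKGibbs.rcLimit_true_real_inter_setOf_forall_not_bdryReach_le (hP : FKGibbs d p q P)
    (hp : p ∈ Set.Icc (0 : ℝ) 1) (hq : 1 ≤ q) {Λ Δ : Finset (Site d)} (hΛΔ : Λ ⊆ Δ)
    {A : Set (BondConfig (Site d))} (hA : IsUpperSet A) (hAΛ : DeterminedBy A ↑(edgesIn (zdGraph d) Λ)) :
    (rcLimit d true p q).real (A ∩ {ω | ∀ x ∈ Λ, ¬ ∃ y ∈ innerBoundary (zdGraph d) Δ,
        (openGraph ω ⊓ withinGraph (zdGraph d) (↑Δ : Set (Site d))).Reachable y x}) ≤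
      P.real (A ∩ {ω | ∀ x ∈ Λ, ¬ ∃ y ∈ innerBoundary (zdGraph d) Δ,
        (openGraph ω ⊓ withinGraph (zdGraph d) (↑Δ : Set (Site d))).Reachable y x}) := by
  classical
  haveI := hP.isProbabilityMeasure
  haveI := isProbabilityMeasure_rcLimit true p q (d := d)
  have hq0 : 0 < q := one_pos.trans_le hq
  set f : BondConfig (Site d) → ℝ := fun ω =>
    ∑ g ∈ Δ.powerset.filter (fun g => Λ ⊆ g),
      {ω : BondConfig (Site d) | ∀ x, x ∈ g ↔ x ∈ Δ ∧ ¬ ∃ y ∈ innerBoundary (zdGraph d) Δ,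
        (openGraph ω ⊓ withinGraph (zdGraph d) (↑Δ : Set (Site d))).Reachable y x}.indicator
        (fun _ => regionFreeReal d p q g A) ω with hf
  -- `∫ (-f) dP ≤ ∫ (-f) dφ¹`, i.e. `∫ f dφ¹ ≤ ∫ f dP`
  have hanti : Antitone f := antitone_sum_indicator_island hp hq Λ Δ hA
  have hmono : Monotone fun ω => -f ω := fun ω ω' h => neg_le_neg (hanti h)
  have hmeas : Measurable fun ω => -f ω := (measurable_sum_indicator_island p q Λ Δ A).neg
  have hbdd : ∀ ω, |-f ω| ≤ 1 := fun ω => by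
    rw [abs_neg]
    exact abs_sum_indicator_island_le_one hp hq0 Λ Δ A ω
  have hint := hP.integral_le_rcLimit_true hp hq hmono hmeas hbdd
  rw [integral_neg, integral_neg, neg_le_neg_iff] at hint
  calc (rcLimit d true p q).real (A ∩ {ω | ∀ x ∈ Λ, ¬ ∃ y ∈ innerBoundary (zdGraph d) Δ,
          (openGraph ω ⊓ withinGraph (zdGraph d) (↑Δ : Set (Site d))).Reachable y x})
      = ∫ ω, f ω ∂(rcLimit d true p q) := by
        rw [(isBoxLimit_rcLimit true hp hq).real_inter_setOf_forall_not_bdryReach_eq_sum hp hq0 hΛΔ hAΛ,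
          hf, integral_sum_indicator_island]
    _ ≤ ∫ ω, f ω ∂P := hint
    _ = ∑ g ∈ Δ.powerset.filter (fun g => Λ ⊆ g), regionFreeReal d p q g A *
          P.real {ω : BondConfig (Site d) | ∀ x, x ∈ g ↔ x ∈ Δ ∧ ¬ ∃ y ∈ innerBoundary (zdGraph d) Δ,
            (openGraph ω ⊓ withinGraph (zdGraph d) (↑Δ : Set (Site d))).Reachable y x} := by
        rw [hf, integral_sum_indicator_island]
    _ ≤ _ := hP.sum_regionFreeReal_mul_real_island_le hΛΔ hA hAΛ

end Box

end Summit.CriticalPhenomena.PercolationContinuityZ3.Theorems.FK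

end
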